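import Summits.ValiantsHypothesis.ValiantsHypothesis.Theorems.LacunarySymmetroidMatrixDescartesCensusTwentyRootStructure
import Summits.ValiantsHypothesis.ValiantsHypothesis.Theorems.LacunarySymmetroidMatrixDescartesCensusEnvelopeToolkit
import Summits.ValiantsHypothesis.ValiantsHypothesis.Theorems.LacunarySymmetroidMatrixDescartesCensusSignChangeCount
import Summits.ValiantsHypothesis.ValiantsHypothesis.Theorems.LacunarySymmetroidMatrixDescartesCensusNineteenKit

/-!
# `MatrixDescartes` census — envelope budget, part 1: sign lemmas and the MIDPOINT BOOKKEEPING of a hypothetical twenty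

HONEST FRAMING.  Object-search cell `pub-symmetroid`, door-A seat `val-sym-door-p1` (items stmt-ValiantsHypothesis-19979 `DoorA26`,
19980 `DoorA34`; OPEN, never asserted).  This is the SETUP half of the envelope budget theorem (`…CensusEnvelopeBudget`:
«along the 20 roots of a hypothetical twenty the type `sign tr F(r_k)` flips at most 3 times», all supports): a few tiny sign
lemmas (kept separate so that non-linear arithmetic runs in a small context; the chaining lemmas are the tree's
`Census.mul_neg_of_mul_pos_of_mul_neg` / `mul_neg_of_mul_neg_of_mul_pos` / `mul_pos_of_mul_neg_of_mul_neg`), `det_nonpos_of_trace_eq_zero`, and `twenty_midpoints` —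
for the 20 simple positive det-roots `r 0 < ⋯ < r 19` of a symmetric six-term `2 × 2` pencil it provides midpoints
`M 0 < r 0 < M 1 < ⋯ < r 19 < M 20` with: `det F(M i) ≠ 0`, ALTERNATING signs of `det F` along the `M i`
(`…SignChangeCount.mul_eval_neg_of_rootMultiplicity_eq_one` + `rootMultiplicity_eq_one_of_twenty`), `tr F(r k) ≠ 0`
(`trace_pencil_eval_ne_zero_of_twenty`), and SIGN TRANSFER of the trace from a definite midpoint to the adjacent roots (a zero of the
trace forces `det ≤ 0`, impossible on a definite gap).  Nothing here bounds `ζ_sym(2,6)`, decides `DoorA26`/`DoorA34`, or bears on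
`MatrixDescartes` (stmt-ValiantsHypothesis-18050) / `VP ≠ VNP`.

[folklore] Intermediate value theorem + Descartes with multiplicity; elementary.
-/

-- `Summit.ValiantsHypothesis.ValiantsHypothesis.…` repeats a component by the D-0017 layout
-- (single-conjunct summit), which the `dupNamespace` linter flags; the name is mandated.
set_option linter.dupNamespace false

namespace Summit.ValiantsHypothesis.ValiantsHypothesis.Theorems.LacunarySymmetroidMatrixDescartes.Census

open Polynomial Finset
open scoped BigOperators Polynomial Matrix
open Summit.ValiantsHypothesis.ValiantsHypothesis.Theorems.SymmetroidDescartes (eval_det_pencil)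

/-! ### Small sign lemmas (kept outside the main proof so that `nlinarith` runs in a tiny context) -/

/-- `a b > 0`, `0 < b` ⇒ `0 < a`. [folklore] -/
theorem sgn_pos_of_mul_pos_of_pos {a b : ℝ} (h : 0 < a * b) (hb : 0 < b) : 0 < a := by
  by_contra h'
  rw [not_lt] at h'
  have := mul_nonpos_of_nonpos_of_nonneg h' hb.le
  exact absurd h (not_lt.mpr this)

/-- `a b < 0`, `b < 0` ⇒ `0 < a`. [folklore] -/
theorem sgn_pos_of_mul_neg_of_neg {a b : ℝ} (h : a * b < 0) (hb : b < 0) : 0 < a := by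
  by_contra h'
  rw [not_lt] at h'
  have := mul_nonneg_of_nonpos_of_nonpos h' hb.le
  exact absurd h (not_lt.mpr this)

/-- `a b < 0`, `0 < a` ⇒ `b < 0`. [folklore] -/
theorem sgn_neg_of_mul_neg_of_pos {a b : ℝ} (h : a * b < 0) (ha : 0 < a) : b < 0 := by
  by_contra h'
  rw [not_lt] at h'
  have := mul_nonneg ha.le h'
  exact absurd h (not_lt.mpr this)

/-- `a b < 0` is impossible when `a < 0` and `b < 0`. [folklore] -/
theorem not_mul_neg_of_neg_of_neg {a b : ℝ} (h : a * b < 0) (ha : a < 0) (hb : b < 0) : False := by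
  have := mul_pos_of_neg_of_neg ha hb
  exact absurd h (not_lt.mpr this.le)

/-- A real symmetric `2 × 2` matrix with zero trace has `det ≤ 0`. [folklore] -/
theorem det_nonpos_of_trace_eq_zero (M : Matrix (Fin 2) (Fin 2) ℝ) (hM : M.IsSymm) (h : M 0 0 + M 1 1 = 0) :
    M.det ≤ 0 := by
  have hs : M 1 0 = M 0 1 := by
    have h' := congrFun (congrFun hM 0) 1
    simpa [Matrix.transpose_apply] using h'
  rw [Matrix.det_fin_two, hs]
  have h11 : M 1 1 = -M 0 0 := by linarith
  rw [h11]
  nlinarith [sq_nonneg (M 0 0), sq_nonneg (M 0 1)]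


/-! ### Midpoint bookkeeping -/

/-- **Midpoint bookkeeping of a hypothetical twenty** (symmetric letters, ANY support).  Given the `20` positive det-roots
`r 0 < ⋯ < r 19` of a real symmetric `2 × 2` six-term pencil (as members of `roots`), there are an integer-indexed extension `R`
of the roots (`R i = r i` for `i < 20`) and MIDPOINTS `M 0 < R 0 < M 1 < R 1 < ⋯ < M 19 < R 19 < M 20` (all positive, increasing) such
that: `det F (M i) ≠ 0`; `det F` ALTERNATES in sign along consecutive midpoints (simple roots); `tr F (R i) ≠ 0`; and on a DEFINITE
midpoint (`det F (M j) > 0`) the trace has the sign of the trace at the two adjacent roots (no zero of the trace on a definite gap).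
This is the setup of the envelope budget theorem (companion file `…CensusEnvelopeBudget`). [folklore] -/
theorem twenty_midpoints (d : Fin 6 → ℕ) (S : Fin 6 → Matrix (Fin 2) (Fin 2) ℝ) (hS : ∀ l, (S l).IsSymm)
    (r : Fin 20 → ℝ) (hr : StrictMono r) (hr0 : ∀ k, 0 < r k)
    (hroot : ∀ k, r k ∈ (Matrix.det (∑ l, ((X : ℝ[X]) ^ d l) • (S l).map C)).roots) :
    ∃ R M : ℕ → ℝ,
      (∀ (i : ℕ) (h : i < 20), R i = r ⟨i, h⟩) ∧
      (∀ i, 0 < M i) ∧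
      (∀ i j, i < j → M i < M j) ∧
      (∀ i, (Matrix.det (∑ l, ((X : ℝ[X]) ^ d l) • (S l).map C)).eval (M i) ≠ 0) ∧
      (∀ i, 0 < i → i ≤ 20 → (Matrix.det (∑ l, ((X : ℝ[X]) ^ d l) • (S l).map C)).eval (M (i - 1)) * (Matrix.det (∑ l, ((X : ℝ[X]) ^ d l) • (S l).map C)).eval (M i) < 0) ∧
      (∀ i, i < 20 → ((∑ l, R i ^ d l • S l) 0 0 + (∑ l, R i ^ d l • S l) 1 1) ≠ 0) ∧
      (∀ j, j < 20 → 0 < (Matrix.det (∑ l, ((X : ℝ[X]) ^ d l) • (S l).map C)).eval (M j) →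
        0 < ((∑ l, M j ^ d l • S l) 0 0 + (∑ l, M j ^ d l • S l) 1 1) * ((∑ l, R j ^ d l • S l) 0 0 + (∑ l, R j ^ d l • S l) 1 1)) ∧
      (∀ j, 0 < j → j ≤ 20 → 0 < (Matrix.det (∑ l, ((X : ℝ[X]) ^ d l) • (S l).map C)).eval (M j) →
        0 < ((∑ l, R (j - 1) ^ d l • S l) 0 0 + (∑ l, R (j - 1) ^ d l • S l) 1 1) * ((∑ l, M j ^ d l • S l) 0 0 + (∑ l, M j ^ d l • S l) 1 1)) := by
  classical
  set p := (Matrix.det (∑ l, ((X : ℝ[X]) ^ d l) • (S l).map C)) with hp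
  -- ## opaque local functions: evaluated pencil `Fm`, trace `T`
  obtain ⟨Fm, hFm⟩ : ∃ Fm : ℝ → Matrix (Fin 2) (Fin 2) ℝ, ∀ x, Fm x = ∑ l, x ^ d l • S l := ⟨_, fun _ => rfl⟩
  obtain ⟨T, hT⟩ : ∃ T : ℝ → ℝ, ∀ x, T x = Fm x 0 0 + Fm x 1 1 := ⟨_, fun _ => rfl⟩
  have hp0 : p ≠ 0 := (mem_roots'.mp (hroot 0)).1
  have hisroot : ∀ k, p.IsRoot (r k) := fun k => (mem_roots'.mp (hroot k)).2
  have hFsym : ∀ x, (Fm x).IsSymm := by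
    intro x
    rw [hFm]
    unfold Matrix.IsSymm
    rw [Matrix.transpose_sum]
    exact Finset.sum_congr rfl fun l _ => by rw [Matrix.transpose_smul, (hS l).eq]
  have hpev : ∀ x, p.eval x = (Fm x).det := fun x => by rw [hp, eval_det_pencil S d x, hFm]
  -- the trace and the quadratic forms as `1 × 1` pencils
  obtain ⟨τ, hτdef⟩ : ∃ τ : ℝ[X], τ = Matrix.det (∑ l, ((X : ℝ[X]) ^ d l) • (!![S l 0 0 + S l 1 1] : Matrix (Fin 1) (Fin 1) ℝ).map C) :=
    ⟨_, rfl⟩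
  have hτ : ∀ x, τ.eval x = T x := by
    intro x
    rw [hτdef, eval_det_pencil_one, hT, hFm, pencil_eval_apply, pencil_eval_apply, ← Finset.sum_add_distrib]
    exact Finset.sum_congr rfl fun l _ => by ring
  have hφ : ∀ (u : Fin 2 → ℝ) (x : ℝ),
      (Matrix.det (∑ l, ((X : ℝ[X]) ^ d l) • (!![u ⬝ᵥ (S l *ᵥ u)] : Matrix (Fin 1) (Fin 1) ℝ).map C)).eval x
        = u ⬝ᵥ (Fm x *ᵥ u) := by
    intro u x
    rw [eval_det_pencil_one, hFm, quadForm_pencil_eval]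
  -- ## the twenty roots are all the positive roots; they are simple; the trace does not vanish at them
  have hsubim : Finset.univ.image r ⊆ p.roots.toFinset.filter (fun t => 0 < t) := by
    intro x hx
    obtain ⟨k, -, rfl⟩ := Finset.mem_image.mp hx
    exact Finset.mem_filter.mpr ⟨Multiset.mem_toFinset.mpr (hroot k), hr0 k⟩
  have hcardim : (Finset.univ.image r).card = 20 := by
    rw [Finset.card_image_of_injective _ hr.injective, Finset.card_univ, Fintype.card_fin]
  have h20 : 20 ≤ (p.roots.toFinset.filter (fun t => 0 < t)).card := hcardim ▸ Finset.card_le_card hsubim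
  have hall : ∀ x, 0 < x → p.IsRoot x → ∃ k, x = r k := by
    intro x hx hxr
    have hle : (p.roots.toFinset.filter (fun t => 0 < t)).card ≤ (Finset.univ.image r).card := by
      rw [hcardim]
      exact (card_posRoots_le_countP_posRoots p).trans (countP_posRoots_det_le_twenty d S)
    have heq := Finset.eq_of_subset_of_card_le hsubim hle
    have hxmem : x ∈ p.roots.toFinset.filter (fun t => 0 < t) :=
      Finset.mem_filter.mpr ⟨Multiset.mem_toFinset.mpr ((mem_roots hp0).mpr hxr), hx⟩
    rw [← heq] at hxmem
    obtain ⟨k, -, hk⟩ := Finset.mem_image.mp hxmem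
    exact ⟨k, hk.symm⟩
  have hmult : ∀ k, p.rootMultiplicity (r k) = 1 := fun k =>
    rootMultiplicity_eq_one_of_twenty d S h20 (hr0 k) (hisroot k)
  have hTr : ∀ k, T (r k) ≠ 0 := by
    intro k
    rw [hT, hFm]
    exact trace_pencil_eval_ne_zero_of_twenty d S hS h20 (hr0 k) (hisroot k)
  -- ## integer-indexed roots `R` and midpoints `M`
  obtain ⟨R, hR⟩ : ∃ R : ℕ → ℝ, ∀ i, R i = if h : i < 20 then r ⟨i, h⟩ else r ⟨19, by norm_num⟩ + i :=
    ⟨_, fun _ => rfl⟩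
  have hRlt : ∀ i (h : i < 20), R i = r ⟨i, h⟩ := by intro i h; rw [hR, dif_pos h]
  have hRge : ∀ i, ¬ i < 20 → R i = r ⟨19, by norm_num⟩ + i := by intro i h; rw [hR, dif_neg h]
  have hRmono : StrictMono R := by
    intro i j hij
    by_cases hj : j < 20
    · have hi : i < 20 := lt_trans hij hj
      rw [hRlt i hi, hRlt j hj]
      exact hr (Fin.mk_lt_mk.mpr hij)
    · rw [hRge j hj]
      by_cases hi : i < 20
      · rw [hRlt i hi]
        have h1 : r ⟨i, hi⟩ ≤ r ⟨19, by norm_num⟩ := hr.monotone (Fin.mk_le_mk.mpr (by omega))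
        have h2 : (20 : ℝ) ≤ (j : ℝ) := by exact_mod_cast (not_lt.mp hj)
        linarith
      · rw [hRge i hi]
        have : (i : ℝ) < (j : ℝ) := by exact_mod_cast hij
        linarith
  have hRpos : ∀ i, 0 < R i := by
    intro i
    by_cases hi : i < 20
    · rw [hRlt i hi]; exact hr0 _
    · rw [hRge i hi]
      have h1 := hr0 ⟨19, by norm_num⟩
      have h2 : (0 : ℝ) ≤ (i : ℝ) := Nat.cast_nonneg i
      linarith
  have hRall : ∀ x, 0 < x → p.IsRoot x → ∃ i, i < 20 ∧ x = R i := by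
    intro x hx hxr
    obtain ⟨k, rfl⟩ := hall x hx hxr
    exact ⟨k.val, k.isLt, by rw [hRlt k.val k.isLt]⟩
  have hRroot : ∀ i, i < 20 → p.IsRoot (R i) := by
    intro i hi; rw [hRlt i hi]; exact hisroot _
  have hRT : ∀ i, i < 20 → T (R i) ≠ 0 := by
    intro i hi; rw [hRlt i hi]; exact hTr _
  have hRmult : ∀ i, i < 20 → p.rootMultiplicity (R i) = 1 := by
    intro i hi; rw [hRlt i hi]; exact hmult _
  obtain ⟨M, hM⟩ : ∃ M : ℕ → ℝ, ∀ i, M i = if i = 0 then R 0 / 2 else (R (i - 1) + R i) / 2 := ⟨_, fun _ => rfl⟩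
  have hM0 : M 0 = R 0 / 2 := by rw [hM]; simp
  have hMi : ∀ i, 0 < i → M i = (R (i - 1) + R i) / 2 := by
    intro i hi; rw [hM]; simp [Nat.pos_iff_ne_zero.mp hi]
  have hMlt : ∀ i, M i < R i := by
    intro i
    by_cases hi : i = 0
    · rw [hi, hM0]; have := hRpos 0; linarith
    · rw [hMi i (Nat.pos_of_ne_zero hi)]
      have := hRmono (show i - 1 < i from Nat.sub_lt (Nat.pos_of_ne_zero hi) one_pos); linarith
  have hMgt : ∀ i, 0 < i → R (i - 1) < M i := by
    intro i hi; rw [hMi i hi]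
    have := hRmono (show i - 1 < i from Nat.sub_lt hi one_pos); linarith
  have hMpos : ∀ i, 0 < M i := by
    intro i
    by_cases hi : i = 0
    · rw [hi, hM0]; have := hRpos 0; linarith
    · exact lt_trans (hRpos _) (hMgt i (Nat.pos_of_ne_zero hi))
  have hMmono : ∀ i j, i < j → M i < M j := by
    intro i j hij
    have h1 : M i < R i := hMlt i
    have h2 : R (j - 1) < M j := hMgt j (by omega)
    have h3 : R i ≤ R (j - 1) := hRmono.monotone (by omega)
    linarith
  have hMle : ∀ i j, i ≤ j → M i ≤ M j := by
    intro i j hij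
    rcases eq_or_lt_of_le hij with h | h
    · rw [h]
    · exact (hMmono i j h).le
  -- a positive root of `p` lies nowhere strictly between `R (i-1)` and `R i`, nor below `R 0`
  have hgap : ∀ z, 0 < z → p.IsRoot z → ∀ i, 0 < i → ¬ (R (i - 1) < z ∧ z < R i) := by
    intro z hz hzr i hi h
    obtain ⟨j, -, rfl⟩ := hRall z hz hzr
    have h1 : i - 1 < j := hRmono.lt_iff_lt.mp h.1
    have h2 : j < i := hRmono.lt_iff_lt.mp h.2
    omega
  have hbelow : ∀ z, 0 < z → p.IsRoot z → ¬ z < R 0 := by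
    intro z hz hzr h
    obtain ⟨j, -, rfl⟩ := hRall z hz hzr
    have := hRmono.lt_iff_lt.mp h
    omega
  -- `p` keeps the sign of `p (M i)` on the punctured gap around `M i`:  `[M 0, R 0)` for `i = 0`, `(R (i-1), R i)` for `i ≥ 1`
  have hsame : ∀ i z, 0 < z → (i = 0 → z < R 0) → (0 < i → R (i - 1) < z ∧ z < R i) → 0 < p.eval z * p.eval (M i) := by
    intro i z hz h0 hi
    have key : ∀ w ∈ Set.Icc (min z (M i)) (max z (M i)), p.eval w ≠ 0 := by
      intro w hw hw0
      have hwr : p.IsRoot w := hw0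
      have hwpos : 0 < w := lt_of_lt_of_le (lt_min hz (hMpos i)) hw.1
      by_cases hi0 : i = 0
      · subst hi0
        exact hbelow w hwpos hwr (lt_of_le_of_lt hw.2 (max_lt (h0 rfl) (hMlt 0)))
      · have hip : 0 < i := Nat.pos_of_ne_zero hi0
        exact hgap w hwpos hwr i hip
          ⟨lt_of_lt_of_le (lt_min (hi hip).1 (hMgt i hip)) hw.1, lt_of_le_of_lt hw.2 (max_lt (hi hip).2 (hMlt i))⟩
    have hprod := Literature.Algebra.Polynomial.Descartes.mul_eval_pos_of_forall_ne_zero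
      (min_le_max : min z (M i) ≤ max z (M i)) key
    rcases le_total z (M i) with hzm | hzm
    · rwa [min_eq_left hzm, max_eq_right hzm] at hprod
    · rwa [min_eq_right hzm, max_eq_left hzm, mul_comm] at hprod
  have hMne : ∀ i, p.eval (M i) ≠ 0 := by
    intro i h0
    have := hsame i (M i) (hMpos i) (fun hi => by rw [hi]; exact hMlt 0)
      (fun hi => ⟨hMgt i hi, hMlt i⟩)
    rw [h0, zero_mul] at this
    exact lt_irrefl _ this
  -- ## alternation of `det` at consecutive midpoints
  have halt : ∀ i, 0 < i → i ≤ 20 → p.eval (M (i - 1)) * p.eval (M i) < 0 := by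
    intro i hi1 hi20
    have hlt : i - 1 < 20 := by omega
    refine mul_eval_neg_of_rootMultiplicity_eq_one (r := R (i - 1)) (hMlt (i - 1)) (hMgt i hi1) (hRmult _ hlt) ?_
    intro z hz hzr
    have hzpos : 0 < z := lt_of_lt_of_le (hMpos _) hz.1
    obtain ⟨j, -, rfl⟩ := hRall z hzpos hzr
    have h2 : ¬ (R (i - 1) < R j) := fun hlt' => by
      have a1 := hRmono.lt_iff_lt.mp hlt'
      have a2 := hRmono.lt_iff_lt.mp (lt_of_le_of_lt hz.2 (hMlt i))
      omega
    have h1 : ¬ (R j < R (i - 1)) := fun hlt' => by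
      have a2 := hRmono.lt_iff_lt.mp hlt'
      by_cases hi2 : i - 1 = 0
      · rw [hi2] at a2; omega
      · have a1 := hRmono.lt_iff_lt.mp (lt_of_lt_of_le (hMgt (i - 1) (Nat.pos_of_ne_zero hi2)) hz.1)
        omega
    exact le_antisymm (not_lt.mp h2) (not_lt.mp h1)
  -- ## definite points: `det > 0` ⇒ every direction has the sign of the trace; a zero of the trace forces `det ≤ 0`
  have hdefT : ∀ x, 0 < p.eval x → ∀ u : Fin 2 → ℝ, u ≠ 0 → 0 < T x * (u ⬝ᵥ (Fm x *ᵥ u)) := by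
    intro x hx u hu
    rw [hpev] at hx; rw [hT]
    exact trace_mul_quadForm_pos_of_det_pos _ (hFsym x) hx u hu
  have hTzero : ∀ x, T x = 0 → p.eval x ≤ 0 := by
    intro x hx
    rw [hpev]
    rw [hT] at hx
    exact det_nonpos_of_trace_eq_zero _ (hFsym x) hx
  -- ## sign transfer across a definite half-gap: `T (M j)` has the sign of `T` at the adjacent roots
  have htransR : ∀ j, j < 20 → 0 < p.eval (M j) → 0 < T (M j) * T (R j) := by
    intro j hj hMj
    have key : ∀ w ∈ Set.Icc (M j) (R j), τ.eval w ≠ 0 := by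
      intro w hw
      rw [hτ]
      rcases eq_or_lt_of_le hw.2 with hwR | hwR
      · rw [hwR]; exact hRT j hj
      · intro hT0
        have hwpos : 0 < w := lt_of_lt_of_le (hMpos j) hw.1
        have hpw : 0 < p.eval w * p.eval (M j) := by
          refine hsame j w hwpos (fun h0 => by rw [h0] at hwR; exact hwR) (fun hjp => ⟨?_, hwR⟩)
          exact lt_of_lt_of_le (hMgt j hjp) hw.1
        have hle := hTzero w hT0
        have hpos := sgn_pos_of_mul_pos_of_pos hpw hMj
        exact absurd hpos (not_lt.mpr hle)
    have := Literature.Algebra.Polynomial.Descartes.mul_eval_pos_of_forall_ne_zero (hMlt j).le key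
    rwa [hτ, hτ] at this
  have htransL : ∀ j, 0 < j → j ≤ 20 → 0 < p.eval (M j) → 0 < T (R (j - 1)) * T (M j) := by
    intro j hj1 hj20 hMj
    have hj' : j - 1 < 20 := by omega
    have key : ∀ w ∈ Set.Icc (R (j - 1)) (M j), τ.eval w ≠ 0 := by
      intro w hw
      rw [hτ]
      rcases eq_or_lt_of_le hw.1 with hwR | hwR
      · rw [← hwR]; exact hRT (j - 1) hj'
      · intro hT0
        have hwpos : 0 < w := lt_trans (hRpos _) hwR
        have hpw : 0 < p.eval w * p.eval (M j) := by
          refine hsame j w hwpos (fun h0 => by omega) (fun _ => ⟨hwR, lt_of_le_of_lt hw.2 (hMlt j)⟩)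
        have hle := hTzero w hT0
        have hpos := sgn_pos_of_mul_pos_of_pos hpw hMj
        exact absurd hpos (not_lt.mpr hle)
    have := Literature.Algebra.Polynomial.Descartes.mul_eval_pos_of_forall_ne_zero (hMgt j hj1).le key
    rwa [hτ, hτ] at this
  -- ## export
  refine ⟨R, M, hRlt, hMpos, hMmono, hMne, halt, ?_, ?_, ?_⟩
  · intro i hi
    have h := hRT i hi
    rwa [hT, hFm] at h
  · intro j hj hMj
    have h := htransR j hj hMj
    rwa [hT, hT, hFm, hFm] at h
  · intro j hj1 hj20 hMj
    have h := htransL j hj1 hj20 hMj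
    rwa [hT, hT, hFm, hFm] at h

end Summit.ValiantsHypothesis.ValiantsHypothesis.Theorems.LacunarySymmetroidMatrixDescartes.Census
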